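import Mathlib.MeasureTheory.Measure.Lebesgue.Basic
import Summits.AnomalousDissipation.AnomalousDissipation.Theorems.SawtoothPulseCascadeK1LocalisedCascadeLineCut

/-!
# K1loc, line `Spectral` — S-D (first good piece): ONE PHASE OF THE LINE REFINEMENT (V-cut then H-cut)

Helper file of the prover lane on the crux `K1LocalisedCascade` (stmt-AnomalousDissipation-19491), route
`SawtoothPulseCascade`, registered line `Cruxes.K1LocalisedCascade.Spectral` (one open stub `stub_highModeConcentration`).
Route (i) of memo v8 §8: a piece `[u, v]` of the horizontal chord is refined by ONE PHASE of the cascade — first by the V-stage flats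
(coordinate `c_V`, affine with slope `λ_V ≠ 0` up to `E_V`), then, inside each V-child `p`, by the H-stage flats (coordinate `c_H`, affine on
every sub-interval where `c_V` stays in the component `p`, with slope `λ_H(p) ≠ 0`, `|λ_H(p)| ≤ Λ_H`, up to `E_H`).  Two applications of
`…K1Start.line_cut` give (`phase_cut`):

* grandchildren `[a p p', b p p'] ⊆ [u, v]`, pairwise disjoint, empty outside the index box `pl ≤ p ≤ ph`, `pl' p ≤ p' ≤ ph' p`;
* on each: `c_V ∈` the `ζ₂`-component `p` and `c_H ∈` the `ζ₂`-component `p'` (the `hgoodV`/`hgoodH` data of `…AffinePair`);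
* the straddle-inclusive COUNT: `ph − pl ≤ 2N|λ_V|(v − u) + 1` and `Σ_p (ph' p − pl' p + 1) ≤ 2NΛ_H(v − u) + 2(2N|λ_V|(v − u) + 2)`
  (via `sum_length_children_le`: disjoint children have total length `≤ v − u`);
* coverage: a point of `[u, v]` in no grandchild has `c_V` or `c_H` within `ζ₁ + max(E_V, E_H)` of a corner.

Abstract in `N ≥ 1`, `0 < ζ₁`, `ζ₂ + E ≤ ζ₁`; nothing cascade-specific. [cite: ElgindiLissMattingly2025, §1 (corner strips)] [problem: turb]
-/

-- `Summit.<Summit>.<Problem>`: single-conjunct summit, the duplicate namespace segment is deliberate.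
set_option linter.dupNamespace false

noncomputable section

namespace Summit.AnomalousDissipation.AnomalousDissipation.Theorems.SawtoothPulseCascade.K1Start

open Set MeasureTheory
open scoped ENNReal

/-! ## §1 Disjoint children have total length at most the parent's -/

/-- **Total length of disjoint sub-intervals.**  If the closed intervals `[a p, b p]`, `p` in a finite set, are pairwise disjoint and
contained in `[u, v]`, then `Σ_p max 0 (b p − a p) ≤ v − u`. [folklore] -/
theorem sum_length_children_le {ι : Type*} (S : Finset ι) {a b : ι → ℝ} {u v : ℝ} (huv : u ≤ v)
    (hsub : ∀ p ∈ S, Icc (a p) (b p) ⊆ Icc u v) (hdisj : ∀ p ∈ S, ∀ q ∈ S, p ≠ q → Disjoint (Icc (a p) (b p)) (Icc (a q) (b q))) :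
    ∑ p ∈ S, max 0 (b p - a p) ≤ v - u := by
  have h1 : ∑ p ∈ S, volume (Icc (a p) (b p)) = volume (⋃ p ∈ S, Icc (a p) (b p)) :=
    (measure_biUnion_finset (fun p hp q hq hpq => hdisj p hp q hq hpq) fun p _ => measurableSet_Icc).symm
  have h2 : volume (⋃ p ∈ S, Icc (a p) (b p)) ≤ volume (Icc u v) :=
    measure_mono (iUnion₂_subset fun p hp => hsub p hp)
  have h3 : ∑ p ∈ S, volume (Icc (a p) (b p)) ≤ ENNReal.ofReal (v - u) := by
    rw [h1, ← Real.volume_Icc]; exact h2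
  have h4 : ∑ p ∈ S, ENNReal.ofReal (max 0 (b p - a p)) ≤ ENNReal.ofReal (v - u) := by
    refine le_trans (le_of_eq (Finset.sum_congr rfl fun p _ => ?_)) h3
    rw [Real.volume_Icc]
    rcases le_or_gt (a p) (b p) with h | h
    · rw [max_eq_right (sub_nonneg.mpr h)]
    · rw [max_eq_left (by linarith), ENNReal.ofReal_zero, ENNReal.ofReal_of_nonpos (by linarith)]
  rw [← ENNReal.ofReal_sum_of_nonneg fun p _ => le_max_left _ _] at h4
  exact (ENNReal.ofReal_le_ofReal_iff (sub_nonneg.mpr huv)).mp h4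

/-! ## §2 One phase: V-cut, then H-cut inside every V-child -/

/-- **One phase of the line refinement.**  Data: `N ≥ 1`; depths `0 < ζ₁`, `ζ₂ + E_V ≤ ζ₁`, `ζ₂ + E_H ≤ ζ₁`; parent `u ≤ v`;
V-coordinate `c_V` with `|c_V(s') − c_V(s) − λ_V(s' − s)| ≤ E_V` on `[u, v]`, `λ_V ≠ 0`; H-coordinate `c_H` which, on every sub-interval of
`[u, v]` where `c_V` stays in the `ζ₂`-component `p`, satisfies `|c_H(s') − c_H(s) − λ_H(p)(s' − s)| ≤ E_H` with `λ_H(p) ≠ 0`, `|λ_H(p)| ≤ Λ_H`.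
Conclusion: V-children `[aV p, bV p]` (`pl ≤ p ≤ ph`, `ph − pl ≤ 2N|λ_V|(v−u) + 1`) and grandchildren `[a p p', b p p'] ⊆ [aV p, bV p] ⊆ [u, v]`
(`pl' p ≤ p' ≤ ph' p`, `ph' p − pl' p ≤ 2N|λ_H p|·max 0 (bV p − aV p) + 1`, total V-length `≤ v − u`), pairwise disjoint, with
`c_V ∈` component `p` and `c_H ∈` component `p'` on `[a p p', b p p']`, and every uncovered point of `[u, v]` has `c_V` within `ζ₁ + E_V` or
`c_H` within `ζ₁ + E_H` of a corner `(m/2 + 1/4)/N`. [cite: ElgindiLissMattingly2025, §1 (corner strips)] -/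
theorem phase_cut {N : ℕ} (hN : 0 < N) {ζ₁ ζ₂ EV EH lamV ΛH u v : ℝ} (hζ₁ : 0 < ζ₁) (hζV : ζ₂ + EV ≤ ζ₁) (hζH : ζ₂ + EH ≤ ζ₁)
    (huv : u ≤ v) (hlamV : lamV ≠ 0) {cV cH : ℝ → ℝ} (lamH : ℤ → ℝ) (hlamH : ∀ p, lamH p ≠ 0) (hΛH : ∀ p, |lamH p| ≤ ΛH)
    (hcV : ∀ s ∈ Icc u v, ∀ s' ∈ Icc u v, |cV s' - cV s - lamV * (s' - s)| ≤ EV)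
    (hcH : ∀ (p : ℤ) (a b : ℝ), Icc a b ⊆ Icc u v →
      (∀ s ∈ Icc a b, cV s ∈ Icc (((p : ℝ) / 2 - 1 / 4) / N + ζ₂) (((p : ℝ) / 2 + 1 / 4) / N - ζ₂)) →
      ∀ s ∈ Icc a b, ∀ s' ∈ Icc a b, |cH s' - cH s - lamH p * (s' - s)| ≤ EH) :
    ∃ (pl ph : ℤ) (aV bV : ℤ → ℝ) (pl' ph' : ℤ → ℤ) (a b : ℤ → ℤ → ℝ),
      ((ph : ℝ) - pl ≤ 2 * N * |lamV| * (v - u) + 1) ∧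
      (∀ p, (p < pl ∨ ph < p) → bV p < aV p) ∧
      (∑ p ∈ Finset.Icc pl ph, max 0 (bV p - aV p) ≤ v - u) ∧
      (∀ p, ((ph' p : ℝ) - pl' p ≤ 2 * N * |lamH p| * max 0 (bV p - aV p) + 1)) ∧
      (∑ p ∈ Finset.Icc pl ph, ((ph' p : ℝ) - pl' p + 1) ≤ 2 * N * ΛH * (v - u) + 2 * (2 * N * |lamV| * (v - u) + 2)) ∧
      (∀ p p', (p' < pl' p ∨ ph' p < p') → b p p' < a p p') ∧
      (∀ p p', Icc (a p p') (b p p') ⊆ Icc (aV p) (bV p) ∧ Icc (aV p) (bV p) ⊆ Icc u v) ∧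
      (∀ p p' q q', (p, p') ≠ (q, q') → Disjoint (Icc (a p p') (b p p')) (Icc (a q q') (b q q'))) ∧
      (∀ p p', ∀ s ∈ Icc (a p p') (b p p'),
        cV s ∈ Icc (((p : ℝ) / 2 - 1 / 4) / N + ζ₂) (((p : ℝ) / 2 + 1 / 4) / N - ζ₂) ∧
        cH s ∈ Icc (((p' : ℝ) / 2 - 1 / 4) / N + ζ₂) (((p' : ℝ) / 2 + 1 / 4) / N - ζ₂)) ∧
      (∀ s ∈ Icc u v, (∃ p p', pl ≤ p ∧ p ≤ ph ∧ pl' p ≤ p' ∧ p' ≤ ph' p ∧ s ∈ Icc (a p p') (b p p')) ∨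
        (∃ m : ℤ, |cV s - ((m : ℝ) / 2 + 1 / 4) / N| < ζ₁ + EV) ∨
        (∃ m : ℤ, |cH s - ((m : ℝ) / 2 + 1 / 4) / N| < ζ₁ + EH)) := by
  -- the V-cut
  have hcV' : ∀ s ∈ Icc u v, |cV s - (lamV * s + (cV u - lamV * u))| ≤ EV := by
    intro s hs
    have h := hcV u (left_mem_Icc.mpr huv) s hs
    rwa [show cV s - (lamV * s + (cV u - lamV * u)) = cV s - cV u - lamV * (s - u) by ring]
  obtain ⟨pl, ph, aV, bV, hcountV, hsubV, hemptyV, hdisjV, htrueV, hcoverV⟩ := line_cut hN hζV hζ₁ hlamV hcV'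
  -- the H-cut inside each V-child (also performed, vacuously, on empty children)
  have hH : ∀ p, ∃ (pl' ph' : ℤ) (a b : ℤ → ℝ),
      ((ph' : ℝ) - pl' ≤ 2 * N * |lamH p| * max 0 (bV p - aV p) + 1) ∧
      (∀ p', Icc (a p') (b p') ⊆ Icc (aV p) (bV p)) ∧
      (∀ p', (p' < pl' ∨ ph' < p') → b p' < a p') ∧
      (∀ p' q', p' ≠ q' → Disjoint (Icc (a p') (b p')) (Icc (a q') (b q'))) ∧
      (∀ p', ∀ s ∈ Icc (a p') (b p'), cH s ∈ Icc (((p' : ℝ) / 2 - 1 / 4) / N + ζ₂) (((p' : ℝ) / 2 + 1 / 4) / N - ζ₂)) ∧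
      (∀ s ∈ Icc (aV p) (bV p), (∃ p', pl' ≤ p' ∧ p' ≤ ph' ∧ s ∈ Icc (a p') (b p')) ∨
        ∃ m : ℤ, |cH s - ((m : ℝ) / 2 + 1 / 4) / N| < ζ₁ + EH) := by
    intro p
    rcases le_or_gt (aV p) (bV p) with hab | hab
    · have hcH' : ∀ s ∈ Icc (aV p) (bV p), |cH s - (lamH p * s + (cH (aV p) - lamH p * aV p))| ≤ EH := by
        intro s hs
        have h := hcH p (aV p) (bV p) (hsubV p) (htrueV p) (aV p) (left_mem_Icc.mpr hab) s hs
        rwa [show cH s - (lamH p * s + (cH (aV p) - lamH p * aV p)) = cH s - cH (aV p) - lamH p * (s - aV p) by ring]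
      obtain ⟨pl', ph', a, b, hc, hs, he, hd, ht, hcov⟩ := line_cut hN hζH hζ₁ (hlamH p) hcH'
      refine ⟨pl', ph', a, b, ?_, hs, he, hd, ht, hcov⟩
      rw [max_eq_right (sub_nonneg.mpr hab)]
      linarith [show (0 : ℝ) ≤ 4 * N * ζ₁ by positivity]
    · -- empty V-child: no grandchildren
      refine ⟨1, 0, fun _ => 1, fun _ => 0, ?_, ?_, ?_, ?_, ?_, ?_⟩
      · have : (0 : ℝ) ≤ 2 * N * |lamH p| * max 0 (bV p - aV p) := by positivity
        push_cast; linarith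
      · intro p' s hs
        have h1 : (1 : ℝ) ≤ s := hs.1
        have h2 : s ≤ 0 := hs.2
        exact absurd (h1.trans h2) (by norm_num)
      · intro p' _; show (0 : ℝ) < 1; norm_num
      · intro p' q' _
        rw [Set.disjoint_iff]
        rintro s ⟨hs, -⟩
        have h1 : (1 : ℝ) ≤ s := hs.1
        have h2 : s ≤ 0 := hs.2
        exact absurd (h1.trans h2) (by norm_num)
      · intro p' s hs
        have h1 : (1 : ℝ) ≤ s := hs.1
        have h2 : s ≤ 0 := hs.2
        exact absurd (h1.trans h2) (by norm_num)
      · intro s hs; exact absurd (hs.1.trans hs.2) (not_le.mpr hab)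
  choose pl' ph' a b hcountH hsubH hemptyH hdisjH htrueH hcoverH using hH
  have hcountV' : (ph : ℝ) - pl ≤ 2 * N * |lamV| * (v - u) + 1 := by
    linarith [show (0 : ℝ) ≤ 4 * N * ζ₁ by positivity]
  have hlen : ∑ p ∈ Finset.Icc pl ph, max 0 (bV p - aV p) ≤ v - u :=
    sum_length_children_le (Finset.Icc pl ph) huv (fun p _ => hsubV p) (fun p _ q _ hpq => hdisjV p q hpq)
  refine ⟨pl, ph, aV, bV, pl', ph', a, b, hcountV', hemptyV, hlen, hcountH, ?_, ?_, ?_, ?_, ?_, ?_⟩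
  · -- the aggregated count
    have hcard : ((Finset.Icc pl ph).card : ℝ) ≤ 2 * N * |lamV| * (v - u) + 2 := by
      rw [Int.card_Icc]
      rcases le_or_gt pl (ph + 1) with h | h
      · have : ((ph + 1 - pl).toNat : ℝ) = (ph : ℝ) + 1 - pl := by
          rw [show ((ph + 1 - pl).toNat : ℝ) = (((ph + 1 - pl).toNat : ℤ) : ℝ) by norm_cast,
            Int.toNat_of_nonneg (by linarith)]
          push_cast; ring
        rw [this]; linarith
      · rw [Int.toNat_eq_zero.mpr (by linarith)]
        push_cast
        have h0 : (0 : ℝ) ≤ 2 * N * |lamV| * (v - u) := mul_nonneg (by positivity) (sub_nonneg.mpr huv)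
        linarith
    calc ∑ p ∈ Finset.Icc pl ph, ((ph' p : ℝ) - pl' p + 1)
        ≤ ∑ p ∈ Finset.Icc pl ph, (2 * N * ΛH * max 0 (bV p - aV p) + 2) := by
          refine Finset.sum_le_sum fun p _ => ?_
          have h1 := hcountH p
          have h2 : 2 * N * |lamH p| * max 0 (bV p - aV p) ≤ 2 * N * ΛH * max 0 (bV p - aV p) :=
            mul_le_mul_of_nonneg_right (mul_le_mul_of_nonneg_left (hΛH p) (by positivity)) (le_max_left _ _)
          linarith
      _ = 2 * N * ΛH * ∑ p ∈ Finset.Icc pl ph, max 0 (bV p - aV p) + 2 * (Finset.Icc pl ph).card := by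
          rw [Finset.sum_add_distrib, Finset.mul_sum, Finset.sum_const, nsmul_eq_mul]; ring
      _ ≤ 2 * N * ΛH * (v - u) + 2 * (2 * N * |lamV| * (v - u) + 2) := by
          have hΛ0 : 0 ≤ ΛH := (abs_nonneg _).trans (hΛH 0)
          have h1 : 2 * N * ΛH * ∑ p ∈ Finset.Icc pl ph, max 0 (bV p - aV p) ≤ 2 * N * ΛH * (v - u) :=
            mul_le_mul_of_nonneg_left hlen (by positivity)
          linarith
  · intro p p' hp'; exact hemptyH p p' hp'
  · intro p p'; exact ⟨hsubH p p', hsubV p⟩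
  · intro p p' q q' hne
    by_cases hpq : p = q
    · subst hpq
      have hp'q' : p' ≠ q' := fun h => hne (by rw [h])
      exact hdisjH p p' q' hp'q'
    · exact Set.disjoint_of_subset (hsubH p p') (hsubH q q') (hdisjV p q hpq)
  · intro p p' s hs
    exact ⟨htrueV p s (hsubH p p' hs), htrueH p p' s hs⟩
  · intro s hs
    rcases hcoverV s hs with ⟨p, hp1, hp2, hsp⟩ | hz
    · rcases hcoverH p s hsp with ⟨p', hq1, hq2, hsq⟩ | hz'
      · exact Or.inl ⟨p, p', hp1, hp2, hq1, hq2, hsq⟩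
      · exact Or.inr (Or.inr hz')
    · exact Or.inr (Or.inl hz)

end Summit.AnomalousDissipation.AnomalousDissipation.Theorems.SawtoothPulseCascade.K1Start
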